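import Mathlib.Analysis.InnerProductSpace.ProdL2
import Literature.Algebra.EuclideanLattices.LatticeGeometryHermiteConstant
import Literature.Algebra.EuclideanLattices.PQCLLLProofs
import Literature.Analysis.InnerProduct.GramSchmidt
import Literature.Probability.RandomMatrix.GramSchmidtProjection
import HarnessLib

/-!
# Hermite's inequality in Gram–Schmidt form, and Schnorr's orthogonal padding

Topic `Literature/Algebra/EuclideanLattices`; namespace `Literature.Algebra.EuclideanLattices`. Everything in this
file is a `theorem` apart from three `private` auxiliary definitions of the padding construction (`inlPad`,
`padVec`, `phantomFamily`); 0 named facts, 0 sorry.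

Let `c₀, …, c_{k-1}` be linearly independent vectors of a real inner product space `E`, `Λ = ∑ ℤ cₜ` the lattice
they generate (rank `k`, living in the `k`-dimensional subspace `W = span ℝ {cₜ}`), `λ₁(Λ) = minNorm Λ` its minimum
distance and `c*₀, …, c*_{k-1}` the Gram–Schmidt vectors (Mathlib `InnerProductSpace.gramSchmidt`). Then
`d(Λ) = ∏ₜ ‖c*ₜ‖` (the tree's `covolume_latticeOfBasis_eq_prod_norm_gramSchmidt`, LLL82 / Cohen GTM 138 Prop. 2.5.4)
and Hermite's inequality `λ₁(Λ)² ≤ γ_k · d(Λ)^{2/k}` (the defining property of the Hermite constant `γ_k`, tree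
`minNorm_sq_le_hermiteConstant_mul_covolume_rpow_holds`, Cassels Ch. IX §7.1; Schnorr 1994 §2 p. 4
«`γ_m = sup{λ₁(L)² d(L)^{-2/m} : for lattices L of rank m}`») reads

* `minNorm_sq_le_hermiteConstant_mul_prod_norm_gramSchmidt_rpow`: `λ₁(Λ)² ≤ γ_k · (∏ₜ ‖c*ₜ‖)^{2/k}`, equivalently
  `minNorm_pow_le_hermiteConstant_rpow_mul_prod_norm_gramSchmidt_self`: `λ₁(Λ)^k ≤ γ_k^{k/2} · ∏ₜ ‖c*ₜ‖` — the form in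
  which Schnorr uses it («By definition of the Hermite constant `γ_β` we have
  `‖b̂ᵢ‖^β ≤ γ_β^{β/2} ‖b̂ᵢ‖ ‖b̂ᵢ₊₁‖ ⋯ ‖b̂ᵢ₊β₋₁‖`», [Schnorr1994] §3, proof of Prop. 5; there `‖b̂ᵢ‖ = λ₁` of the block).

This is Hermite's inequality for a lattice given by GENERATORS inside an arbitrary (possibly larger, possibly
infinite-dimensional) real inner product space: the proof transports the tree's statement for full-rank lattices of a
finite-dimensional inner product space to `W` (`Module.Basis.span`, `finrank_span_eq_card`), where the Gram–Schmidt
vectors are the same (`gramSchmidt_map_linearIsometry` for the isometric inclusion `W ↪ E`) and so is the minimum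
distance (`minNorm_map_linearIsometry`).

* `minNorm_pow_le_hermiteConstant_rpow_mul_prod_norm_gramSchmidt` (**orthogonal padding**): for `1 ≤ k ≤ n`,
  `λ₁(Λ)^k ≤ γ_n^{n/2} · ∏ₜ ‖c*ₜ‖`. This is the step by which [Schnorr1994], proof of Prop. 5 (p. 6, «We extend the
  basis `b₁, …, b_m` by `β − 2` additional vectors … such that 1. `‖bᵢ‖ = ‖b₁‖` for `i ≤ 0`, 2. `⟨bᵢ, bⱼ⟩ = 0` for
  `i ≤ 0, i ≠ j`»), obtains Hermite inequalities with the constant `γ_β` for the short blocks at the start of a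
  `β`-BKZ basis: the lattice `Λ ⊕ λ₁(Λ)·ℤ^{n-k}` (orthogonal sum, realised here in `WithLp 2 (E × ℝ^{n-k})`) has rank
  `n`, Gram–Schmidt norms `‖c*₀‖, …, ‖c*_{k-1}‖, λ₁, …, λ₁` and no nonzero vector shorter than `λ₁ = λ₁(Λ)`, so
  Hermite's inequality in rank `n` gives `λ₁² ≤ γ_n (∏ₜ‖c*ₜ‖ · λ₁^{n-k})^{2/n}`, i.e. `λ₁^k ≤ γ_n^{n/2} ∏ₜ ‖c*ₜ‖`.
  (Equivalently `γ_k^k ≤ γ_n^n`; we only record the inequality we need.)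

Consumers: `BKZReducedBases.lean` / `BKZApproximationFactor.lean` (Schnorr's bounds for block Korkin–Zolotarev
bases = [AlbrechtDucas2021] Thm 2.4).

## References
* [Schnorr1994] C. P. Schnorr, *Block reduced lattice bases and successive minima*, Combin. Probab. Comput. 3 (1994)
  507–522, §2 (Hermite constant, p. 4), §3 proof of Proposition 5 (p. 6). Read on the author's version
  (Frankfurt 1996, DNB deposit), pages as there.
* [Cassels1997] J. W. S. Cassels, *An Introduction to the Geometry of Numbers*, Ch. IX §7.1 (Hermite's constant) —
  through the tree theorem `minNorm_sq_le_hermiteConstant_mul_covolume_rpow_holds`.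
* [Cohen1993] H. Cohen, GTM 138, Prop. 2.5.4 (`d(L)² = ∏ ‖b*ᵢ‖²`) — through the tree theorem
  `covolume_latticeOfBasis_eq_prod_norm_gramSchmidt`.
-/

noncomputable section

open Module Submodule MeasureTheory InnerProductSpace Finset
open scoped RealInnerProductSpace

namespace Literature.Algebra.EuclideanLattices

/-! ### Transport of the minimum distance along a linear isometry -/

section Transport

variable {E F : Type*} [NormedAddCommGroup E] [InnerProductSpace ℝ E]
  [NormedAddCommGroup F] [InnerProductSpace ℝ F]

/-- The minimum distance of a `ℤ`-submodule is unchanged under a (not necessarily surjective) linear isometry: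
`λ₁(U L) = λ₁(L)` — the nonzero vectors of `U L` are the images of the nonzero vectors of `L`, with the same norms
(change of orthonormal coordinates / passage to the ambient space; Cassels, *Geometry of Numbers*, Ch. I §4 treats
lattices in coordinates throughout, and the tree's `minNorm_comap_linearIsometryEquiv` is the surjective case).
[cite: Cassels1997, Ch. I §4 (lattices and their lengths under orthonormal change of coordinates)] -/
theorem minNorm_map_linearIsometry (U : F →ₗᵢ[ℝ] E) (L : Submodule ℤ F) :
    minNorm (L.map (U.toLinearMap.restrictScalars ℤ)) = minNorm L := by
  unfold minNorm
  congr 1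
  ext r
  constructor
  · rintro ⟨x, ⟨hx, hx0⟩, rfl⟩
    obtain ⟨y, hy, rfl⟩ := Submodule.mem_map.1 hx
    refine ⟨y, ⟨hy, fun h => hx0 ?_⟩, ?_⟩
    · simp [h]
    · simp
  · rintro ⟨y, ⟨hy, hy0⟩, rfl⟩
    refine ⟨U y, ⟨Submodule.mem_map.2 ⟨y, hy, rfl⟩, fun h => hy0 ?_⟩, U.norm_map y⟩
    exact U.injective (by rw [h, map_zero])

/-- The lattice generated by the images `U cₜ` is the image of the lattice generated by the `cₜ` (plumbing).
[folklore] -/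
private theorem span_range_comp_eq_map {ι : Type*} (U : F →ₗᵢ[ℝ] E) (c : ι → F) :
    span ℤ (Set.range (U ∘ c)) = (span ℤ (Set.range c)).map (U.toLinearMap.restrictScalars ℤ) := by
  rw [Submodule.map_span, ← Set.range_comp]
  rfl

end Transport

/-! ### Hermite's inequality for a lattice given by independent generators -/

section Hermite

variable {E : Type*} [NormedAddCommGroup E] [InnerProductSpace ℝ E]

/-- A nonzero vector of `∑ ℤ cₜ` is at least as long as the shortest Gram–Schmidt vector, so for `k ≥ 1`
the minimum distance of the lattice generated by linearly independent `c₀, …, c_{k-1}` is positive: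
`0 < minₜ ‖c*ₜ‖ ≤ λ₁(∑ ℤ cₜ)` (LLL82 Prop. 1.11, tree `minNorm_span_ge_iInf_norm_gramSchmidt_holds`).
[cite: LenstraLenstraLovasz1982, proof of Prop. 1.11] -/
theorem minNorm_span_pos_of_linearIndependent {k : ℕ} {c : Fin k → E} (hc : LinearIndependent ℝ c)
    (hk : 0 < k) : 0 < minNorm (span ℤ (Set.range c)) := by
  haveI : Nonempty (Fin k) := ⟨⟨0, hk⟩⟩
  have h1 := minNorm_span_ge_iInf_norm_gramSchmidt_holds c hc
  obtain ⟨t, ht⟩ := exists_eq_ciInf_of_finite (f := fun i : Fin k => ‖gramSchmidt ℝ c i‖)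
  have hpos : 0 < ⨅ i, ‖gramSchmidt ℝ c i‖ := by
    rw [← ht]
    exact norm_pos_iff.2 (gramSchmidt_ne_zero t hc)
  exact lt_of_lt_of_le hpos h1

/-- **Hermite's inequality in Gram–Schmidt form.** For linearly independent `c₀, …, c_{k-1}` in a real inner product
space, the lattice `Λ = ∑ ℤ cₜ` satisfies `λ₁(Λ)² ≤ γ_k · (∏ₜ ‖c*ₜ‖)^{2/k}` — Hermite's inequality
`λ₁(Λ)² ≤ γ_k d(Λ)^{2/k}` (definition of the Hermite constant, [Schnorr1994] §2 p. 4: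
«`γ_m = sup{λ₁(L)² d(L)^{-2/m}}`», `d(L) = det[⟨bᵢ, bⱼ⟩]^{1/2}` p. 2) with `d(Λ) = ∏ₜ ‖c*ₜ‖`. Proof: Hermite's
inequality of the tree (`minNorm_sq_le_hermiteConstant_mul_covolume_rpow_holds`, Cassels Ch. IX §7.1) in the
`k`-dimensional subspace `W = span ℝ {cₜ}` for the full-rank lattice with basis `cₜ`, whose covolume is `∏ₜ ‖c*ₜ‖`
(`covolume_latticeOfBasis_eq_prod_norm_gramSchmidt`, the Gram–Schmidt vectors computed in `W` being those computed in
`E`), and whose minimum distance is that of `Λ ⊆ E`. For `k = 0` both sides are `0`.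
[cite: Schnorr1994, §2 p. 4 (Hermite constant) and §3 proof of Prop. 5] -/
theorem minNorm_sq_le_hermiteConstant_mul_prod_norm_gramSchmidt_rpow {k : ℕ} {c : Fin k → E}
    (hc : LinearIndependent ℝ c) :
    minNorm (span ℤ (Set.range c)) ^ 2 ≤
      hermiteConstant k * (∏ t, ‖gramSchmidt ℝ c t‖) ^ (2 / (k : ℝ)) := by
  classical
  let W : Submodule ℝ E := span ℝ (Set.range c)
  let bW : Basis (Fin k) ℝ W := Basis.span hc
  letI : MeasurableSpace W := borel W
  haveI : BorelSpace W := ⟨rfl⟩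
  haveI : FiniteDimensional ℝ W := FiniteDimensional.span_of_finite ℝ (Set.finite_range c)
  have hfin : finrank ℝ W = k := by
    rw [finrank_span_eq_card hc, Fintype.card_fin]
  have hcW : (W.subtypeₗᵢ : W → E) ∘ (⇑bW) = c := by
    funext t
    change ((bW t : W) : E) = c t
    rw [Module.Basis.span_apply]
  -- Hermite's inequality in `W`
  have hH := minNorm_sq_le_hermiteConstant_mul_covolume_rpow_holds (E := W)
    (Literature.Computability.Cryptography.latticeOfBasis bW)
  rw [hfin, covolume_latticeOfBasis_eq_prod_norm_gramSchmidt bW] at hH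
  -- Gram–Schmidt norms in `W` are Gram–Schmidt norms in `E`
  have hGS : ∏ t, ‖gramSchmidt ℝ (⇑bW) t‖ = ∏ t, ‖gramSchmidt ℝ c t‖ := by
    refine Finset.prod_congr rfl fun t _ => ?_
    rw [← W.subtypeₗᵢ.norm_map,
      ← Literature.Analysis.InnerProduct.gramSchmidt_map_linearIsometry ℝ W.subtypeₗᵢ (⇑bW) t, hcW]
  -- the minimum distance in `W` is the minimum distance in `E`
  have hmap : (Literature.Computability.Cryptography.latticeOfBasis bW).map
      (W.subtypeₗᵢ.toLinearMap.restrictScalars ℤ) = span ℤ (Set.range c) := by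
    rw [← hcW, span_range_comp_eq_map]
  have hmin : minNorm (Literature.Computability.Cryptography.latticeOfBasis bW) =
      minNorm (span ℤ (Set.range c)) := by
    rw [← hmap, minNorm_map_linearIsometry]
  rw [hGS, hmin] at hH
  exact hH

end Hermite

/-! ### Orthogonal padding (Schnorr's phantom vectors) -/

section Padding

variable {E : Type*} [NormedAddCommGroup E] [InnerProductSpace ℝ E]

/-- The isometric inclusion `E ↪ E ⊕ ℝ^p`, `x ↦ (x, 0)` (auxiliary). [folklore] -/
private def inlPad (p : ℕ) : E →ₗᵢ[ℝ] WithLp 2 (E × EuclideanSpace ℝ (Fin p)) where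
  toLinearMap := (WithLp.linearEquiv 2 ℝ (E × EuclideanSpace ℝ (Fin p))).symm.toLinearMap ∘ₗ
    LinearMap.inl ℝ E (EuclideanSpace ℝ (Fin p))
  norm_map' x := by
    change ‖WithLp.toLp 2 (x, (0 : EuclideanSpace ℝ (Fin p)))‖ = ‖x‖
    simp

/-- `inlPad x = (x, 0)` (auxiliary). [folklore] -/
private theorem inlPad_apply (p : ℕ) (x : E) :
    inlPad p x = WithLp.toLp 2 (x, (0 : EuclideanSpace ℝ (Fin p))) := rfl

/-- The phantom vectors `(0, r·eₛ)`, `s < p` (auxiliary). [folklore] -/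
private def padVec (p : ℕ) (r : ℝ) (s : Fin p) : WithLp 2 (E × EuclideanSpace ℝ (Fin p)) :=
  WithLp.toLp 2 ((0 : E), r • EuclideanSpace.single s (1 : ℝ))

/-- The padded family `(c₀,0), …, (c_{k-1},0), (0, r e₀), …, (0, r e_{p-1})` (auxiliary). [folklore] -/
private def phantomFamily {k : ℕ} (c : Fin k → E) (p : ℕ) (r : ℝ) :
    Fin (k + p) → WithLp 2 (E × EuclideanSpace ℝ (Fin p)) :=
  Fin.append (fun t => inlPad p (c t)) (padVec p r)

/-- The first `k` padded vectors are the `(cₜ, 0)` (auxiliary). [folklore] -/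
private theorem phantomFamily_castAdd {k : ℕ} (c : Fin k → E) (p : ℕ) (r : ℝ) (t : Fin k) :
    phantomFamily c p r (Fin.castAdd p t) = inlPad p (c t) := by
  simp [phantomFamily]

/-- The last `p` padded vectors are the phantoms `(0, r eₛ)` (auxiliary). [folklore] -/
private theorem phantomFamily_natAdd {k : ℕ} (c : Fin k → E) (p : ℕ) (r : ℝ) (s : Fin p) :
    phantomFamily c p r (Fin.natAdd k s) = padVec p r s := by
  simp [phantomFamily]

/-- `(x, 0) ⟂ (0, r eₛ)` (auxiliary). [folklore] -/
private theorem inner_inlPad_padVec (p : ℕ) (x : E) (r : ℝ) (s : Fin p) :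
    ⟪inlPad p x, (padVec p r s : WithLp 2 (E × EuclideanSpace ℝ (Fin p)))⟫ = 0 := by
  simp [inlPad_apply, padVec]

/-- Distinct phantoms are orthogonal (auxiliary). [folklore] -/
private theorem inner_padVec_padVec_of_ne (p : ℕ) (r : ℝ) {s s' : Fin p} (h : s ≠ s') :
    ⟪(padVec p r s : WithLp 2 (E × EuclideanSpace ℝ (Fin p))), padVec p r s'⟫ = 0 := by
  have h1 : ⟪EuclideanSpace.single s (1 : ℝ), EuclideanSpace.single s' (1 : ℝ)⟫ = 0 := by
    rw [orthonormal_iff_ite.1 (EuclideanSpace.orthonormal_single (𝕜 := ℝ) (ι := Fin p)) s s', if_neg h]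
  simp [padVec, real_inner_smul_left, real_inner_smul_right, h1]

omit [InnerProductSpace ℝ E] in
/-- `‖(0, r eₛ)‖ = |r|` (auxiliary). [folklore] -/
private theorem norm_padVec (p : ℕ) (r : ℝ) (s : Fin p) :
    ‖(padVec p r s : WithLp 2 (E × EuclideanSpace ℝ (Fin p)))‖ = |r| := by
  simp [padVec, norm_smul]

/-- If `f n` is orthogonal to all earlier vectors, Gram–Schmidt leaves it unchanged: `f*ₙ = fₙ` — in the
Gram–Schmidt recursion `b*ᵢ = bᵢ − ∑_{j<i} μᵢⱼ b*ⱼ`, `μᵢⱼ = (bᵢ, b*ⱼ)/(b*ⱼ, b*ⱼ)` (LLL82 (1.2)–(1.3)) every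
`μₙⱼ` vanishes, `b*ⱼ` lying in the span of `b₀, …, bⱼ ⟂ bₙ`.
[cite: LenstraLenstraLovasz1982, (1.2)–(1.3) (Gram–Schmidt recursion)] -/
theorem gramSchmidt_eq_self_of_inner_eq_zero {F : Type*} [NormedAddCommGroup F] [InnerProductSpace ℝ F]
    {ι : Type*} [LinearOrder ι] [LocallyFiniteOrderBot ι] [WellFoundedLT ι] (f : ι → F) (n : ι)
    (h : ∀ j < n, ⟪f j, f n⟫ = 0) : gramSchmidt ℝ f n = f n := by
  rw [gramSchmidt_def ℝ f n, sub_eq_self]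
  refine Finset.sum_eq_zero fun i hi => ?_
  have hi' : i < n := Finset.mem_Iio.1 hi
  have hle : span ℝ (f '' Set.Iic i) ≤ (ℝ ∙ f n)ᗮ := by
    refine span_le.2 ?_
    rintro _ ⟨j, hj, rfl⟩
    exact mem_orthogonal_singleton_iff_inner_left.2 (h j (lt_of_le_of_lt (Set.mem_Iic.1 hj) hi'))
  have horth : ⟪gramSchmidt ℝ f i, f n⟫ = 0 :=
    mem_orthogonal_singleton_iff_inner_left.1 (hle (gramSchmidt_mem_span ℝ f le_rfl))
  rw [starProjection_singleton, horth]
  simp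

/-- Gram–Schmidt vectors of the padded family, first part: `(cₜ, 0)* = (c*ₜ, 0)`. [folklore] -/
private theorem gramSchmidt_phantomFamily_castAdd [FiniteDimensional ℝ E] {k : ℕ} (c : Fin k → E) (p : ℕ)
    (r : ℝ) (t : Fin k) :
    gramSchmidt ℝ (phantomFamily c p r) (Fin.castAdd p t) = inlPad p (gramSchmidt ℝ c t) := by
  have hle : k ≤ k + p := Nat.le_add_right k p
  have h1 : phantomFamily c p r ∘ Fin.castLE hle = inlPad p ∘ c := by
    funext t'
    exact phantomFamily_castAdd c p r t'
  have h2 := Literature.Probability.RandomMatrix.gramSchmidt_comp_castLE (𝕜 := ℝ) hle (phantomFamily c p r) t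
  rw [h1, Literature.Analysis.InnerProduct.gramSchmidt_map_linearIsometry ℝ (inlPad p) c t] at h2
  exact h2.symm

/-- Gram–Schmidt vectors of the padded family, second part: the phantom vectors are orthogonal to everything before
them, so `(0, r eₛ)* = (0, r eₛ)`. [folklore] -/
private theorem gramSchmidt_phantomFamily_natAdd [FiniteDimensional ℝ E] {k : ℕ} (c : Fin k → E) (p : ℕ)
    (r : ℝ) (s : Fin p) :
    gramSchmidt ℝ (phantomFamily c p r) (Fin.natAdd k s) = padVec p r s := by
  rw [← phantomFamily_natAdd c p r s]
  refine gramSchmidt_eq_self_of_inner_eq_zero _ _ fun j hj => ?_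
  rw [phantomFamily_natAdd]
  induction j using Fin.addCases with
  | left t => rw [phantomFamily_castAdd]; exact inner_inlPad_padVec p (c t) r s
  | right s' =>
    rw [phantomFamily_natAdd]
    have hs : s' ≠ s := by
      rintro rfl
      exact lt_irrefl _ hj
    exact inner_padVec_padVec_of_ne p r hs

/-- Product of the Gram–Schmidt norms of the padded family: `(∏ₜ ‖c*ₜ‖) · |r|^p`. [folklore] -/
private theorem prod_norm_gramSchmidt_phantomFamily [FiniteDimensional ℝ E] {k : ℕ} (c : Fin k → E) (p : ℕ)
    (r : ℝ) :
    ∏ j, ‖gramSchmidt ℝ (phantomFamily c p r) j‖ = (∏ t, ‖gramSchmidt ℝ c t‖) * |r| ^ p := by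
  rw [Fin.prod_univ_add]
  congr 1
  · refine Finset.prod_congr rfl fun t _ => ?_
    rw [gramSchmidt_phantomFamily_castAdd, (inlPad p).norm_map]
  · rw [Finset.prod_eq_pow_card (b := |r|) fun s _ => ?_, Finset.card_univ, Fintype.card_fin]
    rw [gramSchmidt_phantomFamily_natAdd, norm_padVec]

/-- The padded family is linearly independent (for `r ≠ 0`). [folklore] -/
private theorem linearIndependent_phantomFamily {k : ℕ} {c : Fin k → E} (hc : LinearIndependent ℝ c) (p : ℕ)
    {r : ℝ} (hr : r ≠ 0) : LinearIndependent ℝ (phantomFamily c p r) := by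
  -- the two halves
  have h1 : LinearIndependent ℝ (fun t => inlPad p (c t)) :=
    hc.map' (inlPad p).toLinearMap (LinearMap.ker_eq_bot.2 (inlPad p).injective)
  have h2 : LinearIndependent ℝ (padVec (E := E) p r) := by
    refine linearIndependent_of_ne_zero_of_inner_eq_zero (fun s h0 => hr ?_) fun s s' hss' =>
      inner_padVec_padVec_of_ne p r hss'
    have := norm_padVec (E := E) p r s
    rw [h0, norm_zero] at this
    exact abs_eq_zero.1 this.symm
  -- they span orthogonal, hence disjoint, subspaces
  have h3 : Disjoint (span ℝ (Set.range fun t => inlPad p (c t))) (span ℝ (Set.range (padVec (E := E) p r))) := by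
    refine (Submodule.isOrtho_span.2 ?_).disjoint
    rintro _ ⟨t, rfl⟩ _ ⟨s, rfl⟩
    exact inner_inlPad_padVec p (c t) r s
  have h4 := (h1.sum_type h2 h3)
  -- `Fin.append u v ∘ finSumFinEquiv = Sum.elim u v`
  have h5 : phantomFamily c p r ∘ finSumFinEquiv = Sum.elim (fun t => inlPad p (c t)) (padVec p r) := by
    funext x
    rcases x with t | s
    · simp [phantomFamily_castAdd]
    · simp [phantomFamily_natAdd]
  rw [← h5] at h4
  exact (linearIndependent_equiv _).1 h4

/-- A nonzero integer vector has Euclidean norm at least `1`. [folklore] -/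
private theorem one_le_norm_of_int_ne_zero {p : ℕ} (z : Fin p → ℤ) (hz : z ≠ 0) :
    1 ≤ ‖(WithLp.toLp 2 fun s => (z s : ℝ) : EuclideanSpace ℝ (Fin p))‖ := by
  obtain ⟨s, hs⟩ : ∃ s, z s ≠ 0 := by
    by_contra h
    push Not at h
    exact hz (funext h)
  have h1 : (1 : ℝ) ≤ ((z s : ℝ)) ^ 2 := by
    have : (1 : ℤ) ≤ z s ^ 2 := (one_le_sq_iff_one_le_abs _).2 (Int.one_le_abs hs)
    exact_mod_cast this
  have h2 : ((z s : ℝ)) ^ 2 ≤ ‖(WithLp.toLp 2 fun s => (z s : ℝ) : EuclideanSpace ℝ (Fin p))‖ ^ 2 := by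
    rw [EuclideanSpace.real_norm_sq_eq]
    exact Finset.single_le_sum (f := fun i => ((z i : ℝ)) ^ 2) (fun i _ => sq_nonneg _) (Finset.mem_univ s)
  nlinarith [norm_nonneg (WithLp.toLp 2 fun s => (z s : ℝ) : EuclideanSpace ℝ (Fin p))]

omit [InnerProductSpace ℝ E] in
/-- `∑ₛ zₛ • (r • eₛ) = r • (zₛ)ₛ` in `ℝ^p` (auxiliary bookkeeping). [folklore] -/
private theorem sum_zsmul_smul_single (p : ℕ) (r : ℝ) (z : Fin p → ℤ) :
    ∑ s, z s • (WithLp.ofLp (WithLp.toLp 2 ((0 : E), r • EuclideanSpace.single s (1 : ℝ)))).snd =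
      r • (WithLp.toLp 2 fun s => (z s : ℝ) : EuclideanSpace ℝ (Fin p)) := by
  have : ∀ s, z s • (r • EuclideanSpace.single s (1 : ℝ)) = r • ((z s : ℝ) • EuclideanSpace.single s (1 : ℝ)) := by
    intro s
    rw [← Int.cast_smul_eq_zsmul ℝ, smul_comm]
  simp_rw [this, ← Finset.smul_sum]
  congr 1
  ext i
  rw [WithLp.ofLp_sum, Finset.sum_apply,
    Finset.sum_eq_single i (fun s _ hs => by simp [hs.symm]) (by simp)]
  simp

/-- Every nonzero vector of the padded lattice `∑ ℤ (cₜ,0) + ∑ ℤ (0, r eₛ)` (`0 ≤ r ≤ λ₁(∑ ℤ cₜ)`) has norm at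
least `r`: its second component is `r` times an integer vector, and if that vanishes its first component is a
nonzero vector of `∑ ℤ cₜ`. [cite: Schnorr1994, §3 proof of Prop. 5 (the extended basis)] -/
private theorem le_norm_of_mem_span_phantomFamily {k : ℕ} (c : Fin k → E) (p : ℕ) {r : ℝ} (hr : 0 ≤ r)
    (hrmin : r ≤ minNorm (span ℤ (Set.range c)))
    {w : WithLp 2 (E × EuclideanSpace ℝ (Fin p))} (hw : w ∈ span ℤ (Set.range (phantomFamily c p r)))
    (hw0 : w ≠ 0) : r ≤ ‖w‖ := by
  classical
  obtain ⟨z, rfl⟩ := (Submodule.mem_span_range_iff_exists_fun ℤ).1 hw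
  -- first and second components of `w = ∑ⱼ zⱼ • phantomFamily j`
  set w := ∑ j, z j • phantomFamily c p r j with hwdef
  have hfst : w.fst = ∑ t, z (Fin.castAdd p t) • c t := by
    rw [hwdef, Fin.sum_univ_add]
    simp only [phantomFamily_castAdd, phantomFamily_natAdd, inlPad_apply, padVec, WithLp.add_fst]
    change (WithLp.ofLp (∑ t, z (Fin.castAdd p t) • WithLp.toLp 2 (c t, (0 : EuclideanSpace ℝ (Fin p))))).fst +
      (WithLp.ofLp (∑ s, z (Fin.natAdd k s) •
        WithLp.toLp 2 ((0 : E), r • EuclideanSpace.single s (1 : ℝ)))).fst = _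
    rw [WithLp.ofLp_sum, WithLp.ofLp_sum, Prod.fst_sum, Prod.fst_sum]
    simp
  have hsnd : w.snd = r • (WithLp.toLp 2 fun s => (z (Fin.natAdd k s) : ℝ) : EuclideanSpace ℝ (Fin p)) := by
    rw [hwdef, Fin.sum_univ_add]
    simp only [phantomFamily_castAdd, phantomFamily_natAdd, inlPad_apply, padVec, WithLp.add_snd]
    change (WithLp.ofLp (∑ t, z (Fin.castAdd p t) • WithLp.toLp 2 (c t, (0 : EuclideanSpace ℝ (Fin p))))).snd +
      (WithLp.ofLp (∑ s, z (Fin.natAdd k s) •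
        WithLp.toLp 2 ((0 : E), r • EuclideanSpace.single s (1 : ℝ)))).snd = _
    rw [WithLp.ofLp_sum, WithLp.ofLp_sum, Prod.snd_sum, Prod.snd_sum]
    simp only [WithLp.ofLp_smul, Prod.smul_snd, smul_zero, Finset.sum_const_zero, zero_add]
    exact sum_zsmul_smul_single (E := E) p r fun s => z (Fin.natAdd k s)
  -- `‖w‖² = ‖w.fst‖² + ‖w.snd‖²`
  have hnorm : ‖w‖ ^ 2 = ‖w.fst‖ ^ 2 + ‖w.snd‖ ^ 2 := WithLp.prod_norm_sq_eq_of_L2 w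
  by_cases hz : (fun s => z (Fin.natAdd k s)) = 0
  · -- no phantom part: `w.fst` is a nonzero vector of `∑ ℤ cₜ`
    have hsnd0 : w.snd = 0 := by
      rw [hsnd]
      have : (WithLp.toLp 2 fun s => (z (Fin.natAdd k s) : ℝ) : EuclideanSpace ℝ (Fin p)) = 0 := by
        ext i
        have := congrFun hz i
        simp only [Pi.zero_apply] at this
        simp [this]
      rw [this, smul_zero]
    have hfst0 : w.fst ≠ 0 := by
      intro h0
      apply hw0
      exact (WithLp.ext_iff 2).2 (Prod.ext h0 hsnd0)
    have hmem : w.fst ∈ span ℤ (Set.range c) := by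
      rw [hfst]
      exact Submodule.sum_mem _ fun t _ => Submodule.smul_mem _ _ (subset_span ⟨t, rfl⟩)
    have hle : minNorm (span ℤ (Set.range c)) ≤ ‖w.fst‖ :=
      csInf_le ⟨0, by rintro _ ⟨y, -, rfl⟩; exact norm_nonneg y⟩ ⟨w.fst, ⟨hmem, hfst0⟩, rfl⟩
    have h3 : ‖w.fst‖ ≤ ‖w‖ := by nlinarith [norm_nonneg w, norm_nonneg w.fst, norm_nonneg w.snd]
    exact hrmin.trans (hle.trans h3)
  · -- a phantom part: `‖w.snd‖ = r ‖integer vector‖ ≥ r`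
    have h1 := one_le_norm_of_int_ne_zero (fun s => z (Fin.natAdd k s)) hz
    have h2 : r ≤ ‖w.snd‖ := by
      rw [hsnd, norm_smul, Real.norm_eq_abs, abs_of_nonneg hr]
      nlinarith
    have h3 : ‖w.snd‖ ≤ ‖w‖ := by nlinarith [norm_nonneg w, norm_nonneg w.fst, norm_nonneg w.snd]
    exact h2.trans h3

/-- **Schnorr's orthogonal padding.** For linearly independent `c₀, …, c_{k-1}` (`k ≥ 1`) in a real inner product
space and every `n ≥ k`, the lattice `Λ = ∑ ℤ cₜ` satisfies `λ₁(Λ)^k ≤ γ_n^{n/2} · ∏ₜ ‖c*ₜ‖` — Hermite's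
inequality in rank `n` applied to the orthogonal sum `Λ ⊕ λ₁(Λ)·ℤ^{n-k}` (Gram–Schmidt norms
`‖c*₀‖, …, ‖c*_{k-1}‖, λ₁, …, λ₁`; no nonzero vector shorter than `λ₁`), the extension step of [Schnorr1994], proof of
Proposition 5: «We extend the basis `b₁, …, b_m` by `β − 2` additional vectors … such that 1. `‖bᵢ‖ = ‖b₁‖` for
`i ≤ 0`, 2. `⟨bᵢ, bⱼ⟩ = 0` for `i ≤ 0, i ≠ j` … By definition of the Hermite constant `γ_β` we have
`‖b̂ᵢ‖^β ≤ γ_β^{β/2} ‖b̂ᵢ‖ ‖b̂ᵢ₊₁‖ ⋯ ‖b̂ᵢ₊β₋₁‖`». With `n = k` this is Hermite's inequality itself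
(`minNorm_pow_le_hermiteConstant_rpow_mul_prod_norm_gramSchmidt_self`). The ambient space is assumed finite-dimensional
(orthogonal projections onto spans; every lattice basis lives in one).
[cite: Schnorr1994, §3 proof of Prop. 5 (p. 6)] -/
theorem minNorm_pow_le_hermiteConstant_rpow_mul_prod_norm_gramSchmidt [FiniteDimensional ℝ E] {k n : ℕ}
    {c : Fin k → E} (hc : LinearIndependent ℝ c) (hk : 0 < k) (hkn : k ≤ n) :
    minNorm (span ℤ (Set.range c)) ^ k ≤
      hermiteConstant n ^ ((n : ℝ) / 2) * ∏ t, ‖gramSchmidt ℝ c t‖ := by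
  obtain ⟨p, rfl⟩ := Nat.exists_eq_add_of_le hkn
  set lam := minNorm (span ℤ (Set.range c)) with hlam
  have hlampos : 0 < lam := minNorm_span_pos_of_linearIndependent hc hk
  set P := ∏ t, ‖gramSchmidt ℝ c t‖ with hP
  have hPnn : 0 ≤ P := Finset.prod_nonneg fun t _ => norm_nonneg _
  -- Hermite for the padded lattice
  have hli := linearIndependent_phantomFamily hc p hlampos.ne'
  have hA := minNorm_sq_le_hermiteConstant_mul_prod_norm_gramSchmidt_rpow hli
  rw [prod_norm_gramSchmidt_phantomFamily, abs_of_pos hlampos] at hA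
  -- the padded lattice has no nonzero vector shorter than `lam`
  have hmin : lam ≤ minNorm (span ℤ (Set.range (phantomFamily c p lam))) := by
    have hne : (phantomFamily c p lam (Fin.castAdd p ⟨0, hk⟩)) ≠ 0 := by
      rw [phantomFamily_castAdd]
      intro h0
      have := (inlPad p).norm_map (c ⟨0, hk⟩)
      rw [h0, norm_zero] at this
      exact hc.ne_zero ⟨0, hk⟩ (norm_eq_zero.1 this.symm)
    refine le_csInf ⟨_, _, ⟨subset_span ⟨Fin.castAdd p ⟨0, hk⟩, rfl⟩, hne⟩, rfl⟩ ?_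
    rintro _ ⟨w, ⟨hw, hw0⟩, rfl⟩
    exact le_norm_of_mem_span_phantomFamily c p hlampos.le le_rfl hw hw0
  -- `lam² ≤ γ_n (P lam^p)^{2/n}`
  have hn0 : ((k + p : ℕ) : ℝ) ≠ 0 := by exact_mod_cast (Nat.pos_iff_ne_zero.1 (lt_of_lt_of_le hk hkn))
  set N : ℝ := ((k + p : ℕ) : ℝ) with hN
  have hNpos : 0 < N := by rw [hN]; exact_mod_cast lt_of_lt_of_le hk hkn
  set γ := hermiteConstant (k + p) with hγ
  have hγnn : 0 ≤ γ := hermiteConstant_nonneg _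
  have hQnn : 0 ≤ P * lam ^ p := mul_nonneg hPnn (pow_nonneg hlampos.le _)
  have h1 : lam ^ 2 ≤ γ * (P * lam ^ p) ^ (2 / N) :=
    (pow_le_pow_left₀ hlampos.le hmin 2).trans hA
  -- raise to the power `N/2`
  have h2 : (lam ^ 2) ^ (N / 2) ≤ (γ * (P * lam ^ p) ^ (2 / N)) ^ (N / 2) :=
    Real.rpow_le_rpow (sq_nonneg _) h1 (by positivity)
  have hL : (lam ^ 2) ^ (N / 2) = lam ^ (k + p) := by
    rw [← Real.rpow_natCast lam 2, ← Real.rpow_mul hlampos.le, ← Real.rpow_natCast lam (k + p)]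
    congr 1
    rw [hN]; push_cast; ring
  have hR : (γ * (P * lam ^ p) ^ (2 / N)) ^ (N / 2) = γ ^ (N / 2) * (P * lam ^ p) := by
    rw [Real.mul_rpow hγnn (Real.rpow_nonneg hQnn _), ← Real.rpow_mul hQnn]
    have : 2 / N * (N / 2) = 1 := by field_simp
    rw [this, Real.rpow_one]
  rw [hL, hR, pow_add] at h2
  -- cancel `lam^p > 0`
  have hlp : 0 < lam ^ p := pow_pos hlampos _
  calc lam ^ k = lam ^ k * lam ^ p / lam ^ p := by field_simp
    _ ≤ γ ^ (N / 2) * (P * lam ^ p) / lam ^ p := by gcongr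
    _ = γ ^ (N / 2) * P := by field_simp

/-- Hermite's inequality in product form: `λ₁(∑ ℤ cₜ)^k ≤ γ_k^{k/2} · ∏ₜ ‖c*ₜ‖` for linearly independent
`c₀, …, c_{k-1}`, `k ≥ 1` — the inequality «`‖b̂ᵢ‖^β ≤ γ_β^{β/2} ‖b̂ᵢ‖ ‖b̂ᵢ₊₁‖ ⋯ ‖b̂ᵢ₊β₋₁‖`» of [Schnorr1994],
§3 proof of Prop. 5, once `‖b̂ᵢ‖ = λ₁` of the block. [cite: Schnorr1994, §3 proof of Prop. 5 (p. 6)] -/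
theorem minNorm_pow_le_hermiteConstant_rpow_mul_prod_norm_gramSchmidt_self [FiniteDimensional ℝ E] {k : ℕ}
    {c : Fin k → E} (hc : LinearIndependent ℝ c) (hk : 0 < k) :
    minNorm (span ℤ (Set.range c)) ^ k ≤
      hermiteConstant k ^ ((k : ℝ) / 2) * ∏ t, ‖gramSchmidt ℝ c t‖ :=
  minNorm_pow_le_hermiteConstant_rpow_mul_prod_norm_gramSchmidt hc hk le_rfl

end Padding

end Literature.Algebra.EuclideanLattices

end
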